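import Mathlib
import Summits.Ventures.HodgeRepro.Tier4.Common.TargetDataV3
import Summits.Ventures.HodgeRepro.Tier4.Line1.SpectralOfRTFIsolated

/-!
# Tier4/Line1/RTFConclusionV3 — the direct RTF residual of LINE L1 at the successor target `P_T4v3`: the conclusion
AT THE CHOSEN LEVEL from the RTF inputs, and the `P_T4v3` packer over the RTF residual

Blind re-derivation cell `pub-hodge-repro`, Tier 4 (README §9–§10), seat t4-L1-p1 (gen 3).  Target tree path
`lean/Summits/Ventures/HodgeRepro/Tier4/Line1/RTFConclusionV3.lean`.  Imports typer-1's `Common/TargetDataV3`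
(`TargetData.relevel`, `TargetData.N2`, `TargetData.conclusionAt`, `conclusionAt_of_concrete_P_cocompact`,
`P_T4v3_of_concrete_cocompact`) and this seat's `SpectralOfRTFIsolated` (through it `SpectralOfRTF`:
`P_of_rtf_identification`, `P_of_rtf_isolated`).

WHAT THIS IS (plan-1 S14125: «welcome AFTER the countersign as the by-name twin of `target_L1_of_inputs'` at the chosen
level»).  The successor target `P_T4v3` (ruling (B2), INBOX L7928; frozen S14098) asks, for every datum `d`, SOME deeper
level `Γ'`, SOME re-chosen Albanese lifts `a'` into the same tori with the datum-visible `N2`, and the conclusion AT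
that level.  LINE L1's direct residual theorems are WITNESS-GENERIC (`P_of_rtf_identification` / `P_of_rtf_isolated`
conclude `W.P` for any `W : Witness A`), so at the re-levelled datum `d' := d.relevel Γ' hΓ'.1 a' ha'` and its concrete
witness at its own level they give `d'.conclusionAt Γ'` through typer-1's `conclusionAt_of_concrete_P_cocompact`:
* `conclusionAt_of_rtf_identification` / `conclusionAt_of_rtf_isolated` — the conclusion at the chosen level from the
  RTF inputs on the re-levelled concrete witness ((S1′)+(S3′), resp. (S1″)+(S3″));
* `P_T4v3_of_rtf_identification` / `P_T4v3_of_rtf_isolated` — the `P_T4v3` packers: if for every datum there is a level,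
  lifts with `N2`, cocompactness and the RTF inputs on the re-levelled witness, then `P_T4v3`.
The `N2` conjunct is the prover's CHOICE of the quadruple (p2's CornerCharacters / TorusPair on the RTF side), displayed
here as the hypothesis `hN2` exactly as `P_T4v3_of_concrete_cocompact` displays it; nothing of the seesaw, the
dictionary `tf`, `hcc` or `hlift` is proved here — they are the displayed residual, as in `SpectralOfRTF`.  Nothing here
says anything about the status of the Hodge conjecture for CM abelian varieties, which is NOT proved (HC_CM is NOT
proved by anyone in this repository).
-/

set_option autoImplicit false

noncomputable section

namespace Summit.Ventures.HodgeRepro.Tier4.Line1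

open NumberField Common MeasureTheory RTF

section V3

variable {F E : Type} [Field F] [NumberField F] [IsGalois ℚ F] [IsCMField F]
  [Field E] [NumberField E] [IsGalois ℚ E] [IsCMField E]

/-- **The conclusion of `P_T4v3` AT THE CHOSEN LEVEL from the RTF inputs and the two displayed identities (S1′) + (S3′)**
on the concrete witness of the re-levelled datum `d.relevel Γ' hΓ'.1 a' ha'` at its own level (cocompact by `hcc`). -/
theorem conclusionAt_of_rtf_identification (d : TargetData F E) (Γ' : Set (Matrix (Fin 3) (Fin 3) E))
    (hΓ' : d.IsLevel Γ') (a' : ∀ i : Fin 4, (Fin 2 → ℂ) → (↥(d.T i) → ℂ))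
    (ha' : ∀ i, IsAlbaneseLift (d.T i) (d.Λ i) d.τ₀ d.C Γ' (a' i))
    (hcc : (d.relevel Γ' hΓ'.1 a' ha').IsCocompact Γ')
    {G : Type} [Group G] [TopologicalSpace G] [IsTopologicalGroup G] [MeasurableSpace G] [BorelSpace G]
    (S : RTF.Setting G) {χ : S.T → ℂ} {χ' : S.T' → ℂ} (hχ : S.IsCharacter χ) (hχ' : S.IsCharacter' χ')
    {τ : ℕ → Set (G → ℂ)} {φ : ℕ → G → ℂ} {n : ℕ → ℕ} (hB : S.IsAdaptedONB τ φ n) {f₁ f₂ : G → ℂ}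
    (h₁ : RTF.IsTest f₁) (h₂ : RTF.IsTest f₂) (hconv : RTF.IsTest (S.conv f₁ f₂)) {o₀ : S.Orbit}
    (hiso : S.geoSupport (S.conv f₁ f₂) = {o₀}) (hne : S.orbital χ χ' o₀ (S.conv f₁ f₂) ≠ 0)
    (Lift : ℕ → Prop)
    (hlift : ∀ m, S.PeriodNonzeroT χ (τ m) → S.PeriodNonzeroT' χ' (τ m) → S.Hit (RTF.cj f₁) (τ m) → Lift m)
    (tf : ((d.relevel Γ' hΓ'.1 a' ha').concreteWitness (d.relevel Γ' hΓ'.1 a' ha').isLevel_self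
      (isDomain_dom _ (d.relevel Γ' hΓ'.1 a' ha').isLevel_self).subset_ball
      (isDomain_dom _ (d.relevel Γ' hΓ'.1 a' ha').isLevel_self).measurableSet
      ((d.relevel Γ' hΓ'.1 a' ha').residual_of_cocompact (d.relevel Γ' hΓ'.1 a' ha').isLevel_self hcc)).Translates →
      (G → ℂ) × (G → ℂ))
    (spec : ((d.relevel Γ' hΓ'.1 a' ha').concreteWitness (d.relevel Γ' hΓ'.1 a' ha').isLevel_self
      (isDomain_dom _ (d.relevel Γ' hΓ'.1 a' ha').isLevel_self).subset_ball
      (isDomain_dom _ (d.relevel Γ' hΓ'.1 a' ha').isLevel_self).measurableSet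
      ((d.relevel Γ' hΓ'.1 a' ha').residual_of_cocompact (d.relevel Γ' hΓ'.1 a' ha').isLevel_self hcc)).Translates →
      Finset ℕ)
    (hS1 : SpectralIdentification S χ χ' φ n tf spec) (hS3 : IsolationNonvanishing S χ χ' τ Lift φ n tf spec) :
    (d.relevel Γ' hΓ'.1 a' ha').conclusionAt Γ' :=
  (d.relevel Γ' hΓ'.1 a' ha').conclusionAt_of_concrete_P_cocompact hcc
    (P_of_rtf_identification S χ χ' τ Lift φ n tf spec hχ hχ' hB h₁ h₂ hconv hiso hne hlift hS1 hS3)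

/-- **The conclusion of `P_T4v3` AT THE CHOSEN LEVEL from the RTF inputs and the isolated identities (S1″) + (S3″)**. -/
theorem conclusionAt_of_rtf_isolated (d : TargetData F E) (Γ' : Set (Matrix (Fin 3) (Fin 3) E))
    (hΓ' : d.IsLevel Γ') (a' : ∀ i : Fin 4, (Fin 2 → ℂ) → (↥(d.T i) → ℂ))
    (ha' : ∀ i, IsAlbaneseLift (d.T i) (d.Λ i) d.τ₀ d.C Γ' (a' i))
    (hcc : (d.relevel Γ' hΓ'.1 a' ha').IsCocompact Γ')
    {G : Type} [Group G] [TopologicalSpace G] [IsTopologicalGroup G] [MeasurableSpace G] [BorelSpace G]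
    (S : RTF.Setting G) {χ : S.T → ℂ} {χ' : S.T' → ℂ} (hχ : S.IsCharacter χ) (hχ' : S.IsCharacter' χ')
    {τ : ℕ → Set (G → ℂ)} {φ : ℕ → G → ℂ} {n : ℕ → ℕ} (hB : S.IsAdaptedONB τ φ n) {f₁ f₂ : G → ℂ}
    (h₁ : RTF.IsTest f₁) (h₂ : RTF.IsTest f₂) (hconv : RTF.IsTest (S.conv f₁ f₂)) {o₀ : S.Orbit}
    (hiso : S.geoSupport (S.conv f₁ f₂) = {o₀}) (hne : S.orbital χ χ' o₀ (S.conv f₁ f₂) ≠ 0)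
    (Lift : ℕ → Prop)
    (hlift : ∀ m, S.PeriodNonzeroT χ (τ m) → S.PeriodNonzeroT' χ' (τ m) → S.Hit (RTF.cj f₁) (τ m) → Lift m)
    (tf : ((d.relevel Γ' hΓ'.1 a' ha').concreteWitness (d.relevel Γ' hΓ'.1 a' ha').isLevel_self
      (isDomain_dom _ (d.relevel Γ' hΓ'.1 a' ha').isLevel_self).subset_ball
      (isDomain_dom _ (d.relevel Γ' hΓ'.1 a' ha').isLevel_self).measurableSet
      ((d.relevel Γ' hΓ'.1 a' ha').residual_of_cocompact (d.relevel Γ' hΓ'.1 a' ha').isLevel_self hcc)).Translates →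
      (G → ℂ) × (G → ℂ))
    (hS1 : SpectralIdentificationAt S χ χ' φ n tf) (hS3 : IsolationRealised S χ χ' τ Lift φ n tf) :
    (d.relevel Γ' hΓ'.1 a' ha').conclusionAt Γ' :=
  (d.relevel Γ' hΓ'.1 a' ha').conclusionAt_of_concrete_P_cocompact hcc
    (P_of_rtf_isolated S χ χ' τ Lift φ n tf hχ hχ' hB h₁ h₂ hconv hiso hne hlift hS1 hS3)

end V3

/-- **The `P_T4v3` packer over the isolated RTF residual**: if for every datum there are a deeper level, lifts into the
same tori with `N2`, cocompactness at that level, and the RTF inputs with (S1″) + (S3″) on the re-levelled concrete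
witness, then `P_T4v3`.  The hypothesis is the line's residual at the successor target, every binder displayed. -/
theorem P_T4v3_of_rtf_isolated
    (h : ∀ (F E : Type) [Field F] [NumberField F] [IsGalois ℚ F] [IsCMField F]
      [Field E] [NumberField E] [IsGalois ℚ E] [IsCMField E] (d : TargetData F E),
      ∃ (Γ' : Set (Matrix (Fin 3) (Fin 3) E)) (hΓ' : d.IsLevel Γ') (a' : ∀ i : Fin 4, (Fin 2 → ℂ) → (↥(d.T i) → ℂ))
        (ha' : ∀ i, IsAlbaneseLift (d.T i) (d.Λ i) d.τ₀ d.C Γ' (a' i)),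
        (d.relevel Γ' hΓ'.1 a' ha').N2 ∧
        ∃ hcc : (d.relevel Γ' hΓ'.1 a' ha').IsCocompact Γ',
        ∃ (G : Type) (_ : Group G) (_ : TopologicalSpace G) (_ : IsTopologicalGroup G) (_ : MeasurableSpace G)
          (_ : BorelSpace G) (S : RTF.Setting G) (χ : S.T → ℂ) (χ' : S.T' → ℂ) (τ : ℕ → Set (G → ℂ)) (φ : ℕ → G → ℂ)
          (n : ℕ → ℕ) (f₁ f₂ : G → ℂ) (o₀ : S.Orbit) (Lift : ℕ → Prop)
          (tf : ((d.relevel Γ' hΓ'.1 a' ha').concreteWitness (d.relevel Γ' hΓ'.1 a' ha').isLevel_self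
            (isDomain_dom _ (d.relevel Γ' hΓ'.1 a' ha').isLevel_self).subset_ball
            (isDomain_dom _ (d.relevel Γ' hΓ'.1 a' ha').isLevel_self).measurableSet
            ((d.relevel Γ' hΓ'.1 a' ha').residual_of_cocompact (d.relevel Γ' hΓ'.1 a' ha').isLevel_self hcc)).Translates →
            (G → ℂ) × (G → ℂ)),
          S.IsCharacter χ ∧ S.IsCharacter' χ' ∧ S.IsAdaptedONB τ φ n ∧ RTF.IsTest f₁ ∧ RTF.IsTest f₂ ∧
          RTF.IsTest (S.conv f₁ f₂) ∧ S.geoSupport (S.conv f₁ f₂) = {o₀} ∧ S.orbital χ χ' o₀ (S.conv f₁ f₂) ≠ 0 ∧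
          (∀ m, S.PeriodNonzeroT χ (τ m) → S.PeriodNonzeroT' χ' (τ m) → S.Hit (RTF.cj f₁) (τ m) → Lift m) ∧
          SpectralIdentificationAt S χ χ' φ n tf ∧ IsolationRealised S χ χ' τ Lift φ n tf) :
    P_T4v3 := by
  refine P_T4v3_of_forall fun F E _ _ _ _ _ _ _ _ d => ?_
  obtain ⟨Γ', hΓ', a', ha', hN2, hcc, G, _, _, _, _, _, S, χ, χ', τ, φ, n, f₁, f₂, o₀, Lift, tf, hχ, hχ', hB, h₁, h₂,
    hconv, hiso, hne, hlift, hS1, hS3⟩ := h F E d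
  exact ⟨Γ', hΓ', a', ha', hN2,
    conclusionAt_of_rtf_isolated d Γ' hΓ' a' ha' hcc S hχ hχ' hB h₁ h₂ hconv hiso hne Lift hlift tf hS1 hS3⟩

end Summit.Ventures.HodgeRepro.Tier4.Line1

end
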